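import Literature.Analysis.FluidPDE.OseenHeatKernelBridge
import Literature.Analysis.FluidPDE.OseenDuhamelPairCalculus
import Literature.Analysis.FluidPDE.KochTataruIntegralOfClass
import Literature.Analysis.FluidPDE.KochTataruSliceBMO
import Literature.Analysis.FluidPDE.NSBoundedMildOseenDuhamel
import Literature.Analysis.FluidPDE.WholeSpaceIBP
import Literature.Analysis.FluidPDE.WeakGradientIBP
import Literature.Analysis.FluidPDE.HeatKernelSideFibre
import Literature.Analysis.UnboundedOperators.HeatKernelBoundedData
import Literature.Analysis.UnboundedOperators.HeatKernelHeatEquation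
import Literature.Analysis.UnboundedOperators.HeatKernelGradient
import Literature.Analysis.FunctionSpaces.GaussianSchwartz
import HarnessLib

/-!
# Explicit lower bounds for the Oseen slice constant: `oseenSliceConst ℝ³ ≥ π^{-1/2} > 1/2`

Analysis/FluidPDE support file (everything proved; no definitions, no named facts). The tree's
`L^∞` theory of the Oseen integral equation `u(t) = e^{(t−s)Δ}u(s) − ∫ₛᵗ N_{t−τ}[u(τ), u(τ)] dτ`
(`OseenSlice.lean`, `NSBoundedMildOseen*.lean`, Koch–Nadirashvili–Seregin–Šverák 2009, §3–§4) runs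
on ONE constant, the **slice constant** `C₀ = oseenSliceConst E` of

  `‖N_σ[a, b](x)‖ ≤ C₀ σ^{-1/2} ‖a‖_∞ ‖b‖_∞`   (`norm_oseenSlice_le_oseenSliceConst`; KNSS §3 (3.5), §4 p. 8),

chosen once by `Classical.choose` from `exists_norm_oseenSlice_le` (`OseenDuhamelPairCalculus.lean`).
Being a chosen witness of an `∃ C₀ > 0`, it carries no numerical information upward (no upper bound
is provable about it); but every admissible constant — in particular the chosen one — is bounded
BELOW by any explicitly computed ratio `σ^{1/2}‖N_σ[a, b](x)‖/(‖a‖_∞‖b‖_∞)`. This file computes one: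

* §1–§2 (any finite-dimensional `E`). **The slice with a constant field in the derivative slot is a
  directional derivative of the caloric extension**: for `a ≡ e` and `b` bounded, measurable and
  weakly divergence free, `N_σ[e, b](x) = ∂ₑ(e^{σΔ}b)(x)` (`oseenSlice_const_left_eq_fderiv_heatExtension`).
  This is the structure `N_σ[a,b] = e^{σΔ}P∇·(a ⊗ b)`, `(∇·(a⊗b))_l = Σ_k ∂_k(a_k b_l)` of KNSS §3
  (3.3)–(3.5) in the case `div a = 0`, `a` constant, `div b = 0` (so that `P` does nothing), proved
  without kernel calculus by the annihilator/semigroup/decay argument of the tree's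
  `sum_oseenHeat_smul_eq_oseenSlice` (`OseenHeatKernelBridge.lean`): equal pairings with solenoidal
  tests (`integral_inner_oseenSlice_of_isDivFree` against
  `integral_inner_fderiv_heatExtension_apply_eq_neg` = whole-space integration by parts + self-
  adjointness of `e^{σΔ}` + `∂ₑe^{σΔ}ψ = e^{σΔ}∂ₑψ`), both sides bounded continuous weakly divergence
  free (`IsWeaklyDivFree.fderiv_apply_const`, new), hence equal up to a constant (KNSS Lemma 3.1,
  `BoundedAnnihilator.lean`), and the constant dies under the common semigroup law and the
  `σ^{-1/2}` decay. Corollary: `‖N_σ[e, b]‖ ≤ 2^{d/2}σ^{-1/2}‖b‖_∞‖e‖` (`norm_oseenSlice_const_left_le`).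
* §3–§4 (`ℝ³`). **Shear fields** `g(y₁) v`: their caloric extension is the caloric extension of the
  profile on the line (`heatExtension_shear`, Fubini along the tree's splitting `sideSplit : ℝ³ ≃ ℝ × ℝ²`
  and `G³ = G² ⊗ G¹`, `SideSplitting.lean` / `HeatKernelSideFibre.lean`); for the **Gaussian shear**
  `b_τ = G¹_τ(y₁) v` one gets `e^{σΔ}b_τ = b_{τ+σ}` and, for `v ⊥ e₁`, the CLOSED FORM
  `N_σ[e₁, b_τ](x) = −(x₁ G¹_{τ+σ}(x₁)/(2(τ+σ))) v` (`oseenSlice_single_one_gaussianShear`).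
* §5. Testing the defining inequality at `σ = τ = 1`, `x = 2e₁`, `v = e₀`:
  `G¹_2(2)/2 ≤ C₀ (4π)^{-1/2}`, i.e. `e^{-1/2}/(2√2) ≤ oseenSliceConst ℝ³`
  (`exp_neg_half_div_le_oseenSliceConst`; `= 0.2144…`) and `1/5 ≤ oseenSliceConst ℝ³`
  (`one_fifth_le_oseenSliceConst`).
* §6. General `C¹` shear profiles: `N_σ[e₁, g(·₁)v](x) = (e^{σ∂²}g′)(x₁) v`
  (`oseenSlice_single_one_shear`); with the error-function profile `Φ_τ = ∫_{-r}^{r}G¹_τ ∈ (-1,1)`,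
  `Φ_τ′ = 2G¹_τ`, tested at `x = 0`: `2(4π(1+τ))^{-1/2} ≤ C₀` for every `τ > 0`
  (`two_mul_rpow_le_oseenSliceConst`), hence, letting `τ → 0⁺`, the headline
  **`π^{-1/2} ≤ oseenSliceConst ℝ³`** (`inv_sqrt_pi_le_oseenSliceConst`; `π^{-1/2} = 0.5641…`; this is
  `‖∂G¹_1‖_{L¹} = 2G¹_1(0)`, the best constant among shear data of sup norm one).

Relation to `OseenSliceConstLowerBound.lean` (landed while this file was being written; not
imported here, no declaration shared): that file evaluates the slice of the shear LAYER
`𝟙{y₀>0}e₀ ⊗ e₁` on the CLOSED Koch–Tataru kernel (line integrals of `OseenKernelLineIntegrals`) and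
obtains `inv_sqrt_four_pi_le_oseenSliceConst : (4π)^{-1/2} ≤ C₀` (`0.282…`). The present file is
kernel-free (annihilator/semigroup route through `∂ₑe^{σΔ}b`), proves the structural identity for all
bounded weakly divergence-free `b` in any dimension, and its error-function shear (values in `(-1,1)`,
total variation `2`) gives the constant `π^{-1/2} = 2·(4π)^{-1/2}`, twice the layer's.

Why the cell wants the number (bears_on LADDER-NS N1, crux `EpisodeBase` of
`route-NavierStokesRegularity-PalasekTowerBreakdown`, certificate road): the a-posteriori door
`Germ.LineGermData.exists_sliceRun_of_shadowedRun` (`FluidComputer/PalasekTowerGermHostShadowedRun.lean`)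
asks `2(D+F)·e^{36 C₀² (M+(M+1))² w₀} ≤ δ ≤ 1/2` with `(M+(M+1))²w₀ > 5508` on the register
(`shadowing_exponent_gt_of_speed_face`); with `C₀² ≥ 1/π` the admissible total defect is
`D + F ≤ ¼e^{-36·5508/π} < e^{-63000}` for every admissible reading of `C₀`. WHAT THIS IS NOT: not a
statement about Navier–Stokes solutions — a harmonic-analysis inequality for the kernel of
`e^{σΔ}P∇·` on bounded fields, and an exactly computable slice.

## Mathlib / tree search

`lean search 'oseenSliceConst'` = the definition, `oseenSliceConst_pos`,
`norm_oseenSlice_le_oseenSliceConst` (`OseenDuhamelPairCalculus.lean`) and consumers — no numerical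
bound either way when this file was drafted (the layer bound `inv_sqrt_four_pi_le_oseenSliceConst` of
`OseenSliceConstLowerBound.lean` landed concurrently, see above); `rg 'oseenSlice.*heatExtension b|const_left'`
= ∅. Reused (not
restated): `integral_inner_oseenSlice_of_isDivFree`, `isWeaklyDivFree_oseenSlice`,
`heatExtension_oseenSlice`, `contDiff_oseenSlice` (`OseenSlice` / `OseenHeatKernelBridge`);
`IsWeaklyDivFree.exists_ae_eq_const_of_norm_le_of_forall_integral_inner_eq_zero`
(`BoundedAnnihilator`); `IsWeaklyDivFree.heatExtension_of_bound` (`NSBoundedMildOseenDuhamel`),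
`IsWeaklyDivFree.sub` (`KatoUniqueness`), `VectorCalculus.IsDivFree.isWeaklyDivFree_holds`,
`divergence_eq_sum_inner_fderiv` (`VectorCalculus`); `integral_inner_convect_add_eq_zero`
(`WholeSpaceIBP`), `IsTestFunctionOn.fderiv_apply_const` (`WeakGradientIBP`);
`integral_inner_heatExtension_eq_of_hasCompactSupport` (`KochTataruIntegralOfClass`),
`isPolynomiallyTempered_of_bounded` (`KochTataruSliceBMO`); the bounded-data caloric toolkit
`contDiff_heatExtension_holds`, `heatExtension_add_holds`, `fderiv_heatExtension_apply_of_bounded`,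
`norm_fderiv_heatExtension_apply_le_of_bounded`, `norm_heatExtension_le`, `heatExtension_sub_of_bound`,
`heatExtension_const`, `fderiv_heatExtension_apply_of_hasCompactSupport`, `hasFDerivAt_heatKernel`,
`heatKernel_convolution_heatKernel_holds`, `heatKernel_le`, `FunctionSpaces.contDiff_heatKernel'`
(`UnboundedOperators/HeatKernel*`, `FunctionSpaces/GaussianSchwartz`); `sideSplit`,
`integral_eq_integral_integral_sideSplit`, `sideSplit_symm_apply_one`, `heatKernel_sideSplit_symm`,
`heatKernel_real_apply` (`SideSplitting`, `HeatKernelSideFibre`). Mathlib: `ContDiffAt.isSymmSndFDerivAt`,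
`fderiv_clm_apply`, `InnerProductSpace.toDual_symm_apply`, `EuclideanSpace.proj`,
`EuclideanSpace.basisFun`, `EuclideanSpace.inner_single_left`, `Real.exp_one_lt_d9`,
`intervalIntegral.integral_hasDerivAt_right`, `intervalIntegral.integral_interval_sub_left`,
`setIntegral_le_integral`, `contDiff_one_iff_deriv`, `ContinuousAt.rpow_const`, `le_of_tendsto`.

## References

* G. Koch, N. Nadirashvili, G. Seregin, V. Šverák, *Liouville theorems for the Navier–Stokes
  equations and applications*, Acta Math. 203 (2009) 83–105 = arXiv:0709.3599v1: §3 p. 6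
  ((3.3)–(3.5), the kernel `K_{ijk}` of `S(t)P∂_k` and its bound `|K| ≤ C(|x|²+t)^{-2}`), Lemma 3.1
  p. 7, §4 p. 8 (`‖B(u,v)‖ ≤ C√T‖u‖‖v‖`). [`KochNadirashviliSereginSverak2009`]
* M.-H. Giga, Y. Giga, J. Saal, *Nonlinear Partial Differential Equations*, Birkhäuser 2010,
  §1.1.3 (`L^p`–`L^q` and gradient estimates for `e^{tΔ}`). [`GigaGigaSaal2010`]
-/

noncomputable section

open MeasureTheory Set Function Filter TopologicalSpace InnerProductSpace Metric
open _root_.Topology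
open scoped RealInnerProductSpace ENNReal NNReal

namespace Literature.Analysis.FluidPDE

open UnboundedOperators (heatKernel heatExtension)

variable {E : Type*} [NormedAddCommGroup E] [InnerProductSpace ℝ E] [FiniteDimensional ℝ E]
  [MeasurableSpace E] [BorelSpace E]

/-! ### §1 Directional derivatives of weakly divergence-free fields and of caloric extensions -/

section WeakDiv

omit [FiniteDimensional ℝ E] [MeasurableSpace E] [BorelSpace E] in
/-- Symmetry of second derivatives through the gradient: for `θ ∈ C²`,
`⟪w, ∂ₑ(∇θ)(x)⟫ = D²θ(x)[w, e] = ⟪w, ∇(∂ₑθ)(x)⟫`. [folklore] -/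
private theorem inner_fderiv_gradient_apply_eq [CompleteSpace E] {θ : E → ℝ} (hθ : ContDiff ℝ 2 θ)
    (x e w : E) :
    ⟪w, fderiv ℝ (gradient θ) x e⟫ = ⟪w, gradient (fun y => fderiv ℝ θ y e) x⟫ := by
  have hd : DifferentiableAt ℝ (fderiv ℝ θ) x :=
    ((hθ.fderiv_right (m := 1) le_rfl).differentiable one_ne_zero) x
  -- the gradient is `toDual.symm ∘ fderiv`
  have hgrad : gradient θ = fun y => (InnerProductSpace.toDual ℝ E).symm (fderiv ℝ θ y) := rfl
  have h1 : HasFDerivAt (gradient θ)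
      (((InnerProductSpace.toDual ℝ E).symm : (E →L[ℝ] ℝ) →L[ℝ] E).comp
        (fderiv ℝ (fderiv ℝ θ) x)) x := by
    rw [hgrad]
    exact ((InnerProductSpace.toDual ℝ E).symm : (E →L[ℝ] ℝ) →L[ℝ] E).hasFDerivAt.comp x
      hd.hasFDerivAt
  rw [h1.fderiv, ContinuousLinearMap.comp_apply]
  -- right-hand side
  rw [gradient, fderiv_clm_apply hd (differentiableAt_const e)]
  simp only [fderiv_fun_const, Pi.zero_apply, ContinuousLinearMap.comp_zero, zero_add]
  show ⟪w, (InnerProductSpace.toDual ℝ E).symm _⟫ = ⟪w, (InnerProductSpace.toDual ℝ E).symm _⟫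
  rw [real_inner_comm, InnerProductSpace.toDual_symm_apply, real_inner_comm,
    InnerProductSpace.toDual_symm_apply, ContinuousLinearMap.flip_apply]
  -- symmetry of the second derivative
  exact (hθ.contDiffAt.isSymmSndFDerivAt (by simp)).eq e w

/-- **The directional derivative of a `C²` weakly divergence-free field is weakly divergence free**:
`∫ ⟪∂ₑW, ∇θ⟫ = −∫ ⟪W, ∂ₑ∇θ⟫ = −∫ ⟪W, ∇(∂ₑθ)⟫ = 0` (integration by parts on the whole space,
no boundary terms since `θ ∈ C_c^∞`; `∂ₑθ` is again a test function). [folklore] -/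
private theorem IsWeaklyDivFree.fderiv_apply_const {W : E → E} (hW : IsWeaklyDivFree W)
    (hWs : ContDiff ℝ 2 W) (e : E) : IsWeaklyDivFree (fun x => fderiv ℝ W x e) := by
  haveI : CompleteSpace E := FiniteDimensional.complete ℝ E
  intro θ hθ
  have hθ2 : ContDiff ℝ 2 θ := contDiff_infty.1 hθ.contDiff 2
  -- the gradient of a test function is a `C¹` compactly supported field
  have hg1 : ContDiff ℝ 1 (gradient θ) := by
    have : gradient θ = fun y => (InnerProductSpace.toDual ℝ E).symm (fderiv ℝ θ y) := rfl
    rw [this]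
    exact ((InnerProductSpace.toDual ℝ E).symm : (E →L[ℝ] ℝ) →L[ℝ] E).contDiff.comp
      (hθ2.fderiv_right (m := 1) le_rfl)
  have hgs : HasCompactSupport (gradient θ) :=
    (hθ.hasCompactSupport.fderiv (𝕜 := ℝ)).comp_left (g := (InnerProductSpace.toDual ℝ E).symm)
      (map_zero _)
  -- integration by parts against the constant drift `e`
  have hibp := integral_inner_convect_add_eq_zero (u := fun _ : E => e) (v := W) (w := gradient θ)
    contDiff_const (hWs.of_le one_le_two) hg1 hgs
  have hdiv0 : ∀ x, VectorCalculus.divergence (fun _ : E => e) x = 0 := fun x => by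
    simp [VectorCalculus.divergence]
  simp only [convect_apply, hdiv0, zero_mul, integral_zero, add_zero] at hibp
  -- `∂ₑθ` is a test function, so `∫ ⟪W, ∇(∂ₑθ)⟫ = 0`
  have hθ' : FunctionSpaces.IsTestFunctionOn (⊤ : Opens E) (fun y => fderiv ℝ θ y e) :=
    hθ.fderiv_apply_const e
  have h0 : ∫ x, ⟪W x, fderiv ℝ (gradient θ) x e⟫ = 0 := by
    rw [show (fun x => ⟪W x, fderiv ℝ (gradient θ) x e⟫) =
        fun x => ⟪W x, gradient (fun y => fderiv ℝ θ y e) x⟫ from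
      funext fun x => inner_fderiv_gradient_apply_eq hθ2 x e (W x)]
    exact hW _ hθ'
  linarith

end WeakDiv

/-! ### §2 The slice operator with a constant field in the derivative slot -/

section ConstLeft

variable {b : E → E} {Mb : ℝ}

/-- **Pairing of `∂ₑ e^{ρΔ}b` with a test field**: for bounded measurable `b`, `ρ > 0` and
`ψ ∈ C_c^∞(E; E)`,
`∫ ⟪∂ₑ(e^{ρΔ}b)(x), ψ(x)⟫ dx = −∫ ⟪b(y), ∂ₑ(e^{ρΔ}ψ)(y)⟫ dy`
(integration by parts on the whole space, self-adjointness of `e^{ρΔ}`, and `∂ₑ e^{ρΔ}ψ = e^{ρΔ}∂ₑψ`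
for the test field). This is the right-hand side of the tree's adjoint identity
`integral_inner_oseenSlice_of_isDivFree` for the slice `N_ρ[e, b]` with the constant field `e`.
[cite: KochNadirashviliSereginSverak2009, §3 (3.3)–(3.5) (arXiv:0709.3599v1 p. 6)] -/
theorem integral_inner_fderiv_heatExtension_apply_eq_neg (hbm : Measurable b)
    (hb : ∀ y, ‖b y‖ ≤ Mb) (e : E) {ρ : ℝ} (hρ : 0 < ρ) {ψ : E → E}
    (hψ : FunctionSpaces.IsTestFunctionOn (⊤ : Opens E) ψ) :
    ∫ x, ⟪fderiv ℝ (heatExtension b ρ) x e, ψ x⟫ =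
      -∫ y, ⟪b y, fderiv ℝ (heatExtension ψ ρ) y e⟫ := by
  haveI : CompleteSpace E := FiniteDimensional.complete ℝ E
  have hbmem : MemLp b ∞ (volume : Measure E) :=
    memLp_top_of_bound hbm.aestronglyMeasurable _ (Eventually.of_forall hb)
  have hW : ContDiff ℝ 1 (heatExtension b ρ) :=
    (UnboundedOperators.contDiff_heatExtension_holds hbmem le_top hρ).of_le
      (by exact_mod_cast le_top)
  have hψ1 : ContDiff ℝ 1 ψ := hψ.contDiff.of_le (by exact_mod_cast le_top)
  -- integration by parts against the constant drift `e`
  have hibp := integral_inner_convect_add_eq_zero (u := fun _ : E => e) (v := heatExtension b ρ)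
    (w := ψ) contDiff_const hW hψ1 hψ.hasCompactSupport
  have hdiv0 : ∀ x, VectorCalculus.divergence (fun _ : E => e) x = 0 := fun x => by
    simp [VectorCalculus.divergence]
  simp only [convect_apply, hdiv0, zero_mul, integral_zero, add_zero] at hibp
  -- self-adjointness of the heat semigroup on the second term
  have hg_cont : Continuous fun x => fderiv ℝ ψ x e :=
    (hψ1.continuous_fderiv one_ne_zero).clm_apply continuous_const
  have hg_supp : HasCompactSupport fun x => fderiv ℝ ψ x e :=
    hψ.hasCompactSupport.fderiv_apply (𝕜 := ℝ) e
  have htemp : IsPolynomiallyTempered b :=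
    isPolynomiallyTempered_of_bounded hbm.stronglyMeasurable hb
  have hsa := integral_inner_heatExtension_eq_of_hasCompactSupport htemp hg_cont hg_supp hρ
  have hcomm : ∀ x, heatExtension (fun z => fderiv ℝ ψ z e) ρ x =
      fderiv ℝ (heatExtension ψ ρ) x e := fun x =>
    (UnboundedOperators.fderiv_heatExtension_apply_of_hasCompactSupport hψ1 hψ.hasCompactSupport
      ρ x e).symm
  simp_rw [hcomm] at hsa
  linarith

/-- **The slice operator with a constant field in the derivative slot is the directional
derivative of the caloric extension**: for a constant field `a ≡ e`, a bounded measurable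
*weakly divergence-free* field `b` and `σ > 0`,

  `N_σ[e, b](x) = ∂ₑ (e^{σΔ} b)(x)`.

Indeed `N_σ[a, b] = e^{σΔ} P ∇·(a ⊗ b)` with `(∇·(a ⊗ b))_l = Σ_k ∂_k(a_k b_l) = (div a) b_l +
(a·∇) b_l` (Koch–Nadirashvili–Seregin–Šverák 2009, §3 (3.3)–(3.5): the kernel `K_{ijk}` of
`S(t)P∂_k`); for constant `a ≡ e` and divergence-free `b` the field `∂ₑ b` is divergence free, the
Leray projection does nothing and `e^{σΔ}` commutes with `∂ₑ`. Proof (no kernel calculus, as in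
`sum_oseenHeat_smul_eq_oseenSlice`): both sides are bounded, continuous, weakly divergence free
(`isWeaklyDivFree_oseenSlice`; `IsWeaklyDivFree.heatExtension_of_bound` and
`IsWeaklyDivFree.fderiv_apply_const`) and have the same pairing with solenoidal test fields
(`integral_inner_oseenSlice_of_isDivFree`, `integral_inner_fderiv_heatExtension_apply_eq_neg`), so
they differ by a constant (the `L^∞` annihilator lemma
`IsWeaklyDivFree.exists_ae_eq_const_of_norm_le_of_forall_integral_inner_eq_zero`, KNSS Lemma 3.1);
both are semigroups in `σ` (`heatExtension_oseenSlice`; `heatExtension_add` with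
`fderiv_heatExtension_apply_of_bounded`) decaying like `σ^{-1/2}`
(`norm_oseenSlice_le_oseenSliceConst`, `norm_fderiv_heatExtension_apply_le_of_bounded`), so the
constant vanishes. [cite: KochNadirashviliSereginSverak2009, §3 (3.3)–(3.5) and Lemma 3.1 (arXiv:0709.3599v1 pp. 6–7)] -/
theorem oseenSlice_const_left_eq_fderiv_heatExtension (hbm : Measurable b) (hb : ∀ y, ‖b y‖ ≤ Mb)
    (hdiv : IsWeaklyDivFree b) (e : E) {σ : ℝ} (hσ : 0 < σ) (x : E) :
    oseenSlice σ (fun _ => e) b x = fderiv ℝ (heatExtension b σ) x e := by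
  haveI : CompleteSpace E := FiniteDimensional.complete ℝ E
  have hMb : 0 ≤ Mb := (norm_nonneg _).trans (hb 0)
  have ha : ∀ y : E, ‖(fun _ : E => e) y‖ ≤ ‖e‖ := fun _ => le_rfl
  have hbae : AEStronglyMeasurable b volume := hbm.aestronglyMeasurable
  have hbmem : MemLp b ∞ (volume : Measure E) := memLp_top_of_bound hbae _ (Eventually.of_forall hb)
  -- the caloric extensions of `b`: smooth, bounded, with bounded directional derivative
  have hWs : ∀ {ρ : ℝ}, 0 < ρ → ContDiff ℝ 2 (heatExtension b ρ) := fun {ρ} hρ =>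
    (UnboundedOperators.contDiff_heatExtension_holds hbmem le_top hρ).of_le (by norm_cast)
  have hW0 : ∀ {ρ : ℝ}, 0 < ρ → ∀ z, ‖heatExtension b ρ z‖ ≤ Mb := fun {ρ} hρ z =>
    UnboundedOperators.norm_heatExtension_le hb hρ z
  have hW1 : ∀ {ρ : ℝ}, 0 < ρ → ∀ z, ‖fderiv ℝ (heatExtension b ρ) z e‖ ≤
      (2 : ℝ) ^ ((Module.finrank ℝ E : ℝ) / 2) * ρ ^ (-(1 / 2 : ℝ)) * Mb * ‖e‖ := fun {ρ} hρ z =>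
    UnboundedOperators.norm_fderiv_heatExtension_apply_le_of_bounded hbae hb hρ z e
  -- the two fields and their difference, for every clock `ρ > 0`
  set u : ℝ → E → E := fun ρ z => oseenSlice ρ (fun _ => e) b z with hu
  set v : ℝ → E → E := fun ρ z => fderiv ℝ (heatExtension b ρ) z e with hv
  set w : ℝ → E → E := fun ρ z => u ρ z - v ρ z with hw
  -- the decay constant
  set A : ℝ := oseenSliceConst E * ‖e‖ * Mb + (2 : ℝ) ^ ((Module.finrank ℝ E : ℝ) / 2) * Mb * ‖e‖
    with hA
  have hC₀ := (oseenSliceConst_pos (E := E)).le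
  have hA0 : 0 ≤ A := by positivity
  -- bounds
  have hu_bd : ∀ {ρ : ℝ}, 0 < ρ → ∀ z, ‖u ρ z‖ ≤ oseenSliceConst E * ‖e‖ * Mb * ρ ^ (-(1 / 2 : ℝ)) := by
    intro ρ hρ z
    simp only [hu]
    calc ‖oseenSlice ρ (fun _ => e) b z‖ ≤ oseenSliceConst E * ρ ^ (-(1 / 2 : ℝ)) * ‖e‖ * Mb :=
          norm_oseenSlice_le_oseenSliceConst hρ ha hb z
      _ = oseenSliceConst E * ‖e‖ * Mb * ρ ^ (-(1 / 2 : ℝ)) := by ring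
  have hv_bd : ∀ {ρ : ℝ}, 0 < ρ → ∀ z,
      ‖v ρ z‖ ≤ (2 : ℝ) ^ ((Module.finrank ℝ E : ℝ) / 2) * Mb * ‖e‖ * ρ ^ (-(1 / 2 : ℝ)) := by
    intro ρ hρ z
    simp only [hv]
    calc ‖fderiv ℝ (heatExtension b ρ) z e‖
        ≤ (2 : ℝ) ^ ((Module.finrank ℝ E : ℝ) / 2) * ρ ^ (-(1 / 2 : ℝ)) * Mb * ‖e‖ := hW1 hρ z
      _ = (2 : ℝ) ^ ((Module.finrank ℝ E : ℝ) / 2) * Mb * ‖e‖ * ρ ^ (-(1 / 2 : ℝ)) := by ring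
  have hw_bd : ∀ {ρ : ℝ}, 0 < ρ → ∀ z, ‖w ρ z‖ ≤ A * ρ ^ (-(1 / 2 : ℝ)) := by
    intro ρ hρ z
    simp only [hw]
    calc ‖u ρ z - v ρ z‖ ≤ ‖u ρ z‖ + ‖v ρ z‖ := norm_sub_le _ _
      _ ≤ oseenSliceConst E * ‖e‖ * Mb * ρ ^ (-(1 / 2 : ℝ)) +
            (2 : ℝ) ^ ((Module.finrank ℝ E : ℝ) / 2) * Mb * ‖e‖ * ρ ^ (-(1 / 2 : ℝ)) :=
          add_le_add (hu_bd hρ z) (hv_bd hρ z)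
      _ = A * ρ ^ (-(1 / 2 : ℝ)) := by rw [hA]; ring
  -- continuity
  have hu_cont : ∀ {ρ : ℝ}, 0 < ρ → Continuous (u ρ) := fun {ρ} hρ =>
    (contDiff_oseenSlice hρ measurable_const hbm ha hb (n := 0)).continuous
  have hv_cont : ∀ {ρ : ℝ}, 0 < ρ → Continuous (v ρ) := fun {ρ} hρ =>
    (((hWs hρ).of_le one_le_two).continuous_fderiv one_ne_zero).clm_apply continuous_const
  have hw_cont : ∀ {ρ : ℝ}, 0 < ρ → Continuous (w ρ) := fun {ρ} hρ =>
    (hu_cont hρ).sub (hv_cont hρ)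
  -- Step 1: the difference is a constant field
  have hconst : ∀ {ρ : ℝ}, 0 < ρ → ∃ c : E, ∀ z, w ρ z = c := by
    intro ρ hρ
    have hum : MemLp (u ρ) ∞ volume := memLp_top_of_bound (hu_cont hρ).aestronglyMeasurable _
      (Eventually.of_forall (hu_bd hρ))
    have hvm : MemLp (v ρ) ∞ volume := memLp_top_of_bound (hv_cont hρ).aestronglyMeasurable _
      (Eventually.of_forall (hv_bd hρ))
    have hdiv_u : IsWeaklyDivFree (u ρ) := isWeaklyDivFree_oseenSlice hρ measurable_const hbm ha hb
    have hdiv_v : IsWeaklyDivFree (v ρ) :=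
      (hdiv.heatExtension_of_bound hbae hb hρ).fderiv_apply_const (hWs hρ) e
    have hdiv_w : IsWeaklyDivFree (w ρ) := IsWeaklyDivFree.sub le_top hdiv_u hdiv_v hum hvm
    have horth : ∀ φ : E → E, FunctionSpaces.IsTestFunctionOn (⊤ : Opens E) φ →
        VectorCalculus.IsDivFree φ → ∫ z, ⟪w ρ z, φ z⟫ = 0 := by
      intro φ hφ hφdiv
      have hφc := hφ.hasCompactSupport
      have hφcont := hφ.contDiff.continuous
      have h1 : Integrable fun z => ‖φ z‖ := (hφcont.norm).integrable_of_hasCompactSupport hφc.norm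
      have hint_u : Integrable fun z => ⟪u ρ z, φ z⟫ := by
        refine ((h1.const_mul (oseenSliceConst E * ‖e‖ * Mb * ρ ^ (-(1 / 2 : ℝ)))).mono'
          ((hu_cont hρ).inner hφcont).aestronglyMeasurable (Eventually.of_forall fun z => ?_))
        rw [Real.norm_eq_abs]
        exact (abs_real_inner_le_norm _ _).trans
          (mul_le_mul_of_nonneg_right (hu_bd hρ z) (norm_nonneg _))
      have hint_v : Integrable fun z => ⟪v ρ z, φ z⟫ := by
        refine ((h1.const_mul ((2 : ℝ) ^ ((Module.finrank ℝ E : ℝ) / 2) * Mb * ‖e‖ *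
          ρ ^ (-(1 / 2 : ℝ)))).mono' ((hv_cont hρ).inner hφcont).aestronglyMeasurable
          (Eventually.of_forall fun z => ?_))
        rw [Real.norm_eq_abs]
        exact (abs_real_inner_le_norm _ _).trans
          (mul_le_mul_of_nonneg_right (hv_bd hρ z) (norm_nonneg _))
      have hsplit : ∫ z, ⟪w ρ z, φ z⟫ = (∫ z, ⟪u ρ z, φ z⟫) - ∫ z, ⟪v ρ z, φ z⟫ := by
        rw [← integral_sub hint_u hint_v]
        refine integral_congr_ae (Eventually.of_forall fun z => ?_)
        simp only [hw, inner_sub_left]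
      rw [hsplit]
      simp only [hu, hv]
      rw [integral_inner_oseenSlice_of_isDivFree hρ measurable_const hbm ha hb hφ hφdiv,
        integral_inner_fderiv_heatExtension_apply_eq_neg hbm hb e hρ hφ, sub_self]
    obtain ⟨c, hc⟩ :=
      IsWeaklyDivFree.exists_ae_eq_const_of_norm_le_of_forall_integral_inner_eq_zero
        (hw_cont hρ).aestronglyMeasurable (hw_bd hρ) hdiv_w horth
    refine ⟨c, fun z => ?_⟩
    have heq : w ρ = fun _ => c := ((hw_cont hρ).ae_eq_iff_eq volume continuous_const).1 hc
    exact congr_fun heq z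
  -- Step 2: the semigroup law for the difference
  have hsemi : ∀ {ρ t : ℝ}, 0 < ρ → 0 < t → ∀ z, w (ρ + t) z = heatExtension (w ρ) t z := by
    intro ρ t hρ ht z
    have hsub : heatExtension (w ρ) t z = heatExtension (u ρ) t z - heatExtension (v ρ) t z :=
      UnboundedOperators.heatExtension_sub_of_bound (hu_cont hρ) (hv_cont hρ) (hu_bd hρ) (hv_bd hρ)
        ht z
    rw [hsub]
    have hU : heatExtension (u ρ) t z = u (ρ + t) z := by
      simp only [hu]
      exact heatExtension_oseenSlice hρ ht measurable_const hbm ha hb z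
    have hV : heatExtension (v ρ) t z = v (ρ + t) z := by
      simp only [hv]
      rw [← UnboundedOperators.heatExtension_add_holds hbmem le_top hρ ht]
      exact (UnboundedOperators.fderiv_heatExtension_apply_of_bounded
        ((hWs hρ).of_le one_le_two) (hW0 hρ) (hW1 hρ) ht z).symm
    rw [hU, hV]
  -- Step 3: the constant vanishes
  have hzero : ∀ {ρ : ℝ}, 0 < ρ → ∀ z, w ρ z = 0 := by
    intro ρ hρ z
    obtain ⟨c, hc⟩ := hconst hρ
    have hct : ∀ {t : ℝ}, 0 < t → ‖c‖ ≤ A * t ^ (-(1 / 2 : ℝ)) := by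
      intro t ht
      have h1 : w (ρ + t) 0 = c := by
        rw [hsemi hρ ht 0]
        have : w ρ = fun _ => c := funext hc
        rw [this, UnboundedOperators.heatExtension_const c ht]
      calc ‖c‖ = ‖w (ρ + t) 0‖ := by rw [h1]
        _ ≤ A * (ρ + t) ^ (-(1 / 2 : ℝ)) := hw_bd (by linarith) 0
        _ ≤ A * t ^ (-(1 / 2 : ℝ)) := by
            refine mul_le_mul_of_nonneg_left ?_ hA0
            exact Real.rpow_le_rpow_of_nonpos ht (by linarith) (by norm_num)
    have hlim : Tendsto (fun t : ℝ => A * t ^ (-(1 / 2 : ℝ))) atTop (𝓝 0) := by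
      have := (tendsto_rpow_neg_atTop (by norm_num : (0 : ℝ) < 1 / 2)).const_mul A
      rw [mul_zero] at this
      exact this
    have hle : ‖c‖ ≤ 0 :=
      ge_of_tendsto hlim (Filter.eventually_atTop.2 ⟨1, fun t ht => hct (by linarith)⟩)
    have hc0 : c = 0 := norm_le_zero_iff.1 hle
    rw [hc z, hc0]
  have := hzero hσ x
  simp only [hw, hu, hv, sub_eq_zero] at this
  exact this

/-- **Explicit slice bound for a constant derivative slot**: `‖N_σ[e, b](x)‖ ≤ 2^{d/2} σ^{-1/2}
‖b‖_∞ ‖e‖` for bounded measurable weakly divergence-free `b` (`d = dim E`), from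
`oseenSlice_const_left_eq_fderiv_heatExtension` and the caloric gradient bound
`‖∇e^{σΔ}f‖_∞ ≤ 2^{d/2}σ^{-1/2}‖f‖_∞` (Giga–Giga–Saal §1.1.3, tree
`norm_fderiv_heatExtension_apply_le_of_bounded`). [cite: GigaGigaSaal2010, §1.1.3] -/
theorem norm_oseenSlice_const_left_le (hbm : Measurable b) (hb : ∀ y, ‖b y‖ ≤ Mb)
    (hdiv : IsWeaklyDivFree b) (e : E) {σ : ℝ} (hσ : 0 < σ) (x : E) :
    ‖oseenSlice σ (fun _ => e) b x‖ ≤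
      (2 : ℝ) ^ ((Module.finrank ℝ E : ℝ) / 2) * σ ^ (-(1 / 2 : ℝ)) * Mb * ‖e‖ := by
  haveI : CompleteSpace E := FiniteDimensional.complete ℝ E
  rw [oseenSlice_const_left_eq_fderiv_heatExtension hbm hb hdiv e hσ x]
  exact UnboundedOperators.norm_fderiv_heatExtension_apply_le_of_bounded hbm.aestronglyMeasurable
    hb hσ x e

end ConstLeft

/-! ### §3 Shear fields `g(x₁) v` on `ℝ³`: the caloric extension is the caloric extension of the
profile on the line -/

section Shear

/-- Continuity of a shear field `x ↦ g(x₁) • v` with continuous profile. [folklore] -/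
private theorem continuous_shear {V : Type*} [NormedAddCommGroup V] [NormedSpace ℝ V] {g : ℝ → ℝ}
    (hgc : Continuous g) (v : V) :
    Continuous fun y : EuclideanSpace ℝ (Fin 3) => g (y 1) • v :=
  (hgc.comp ((continuous_apply 1).comp (PiLp.continuous_ofLp 2 _))).smul continuous_const

/-- The size of a shear field: `‖g(x₁) • v‖ ≤ C ‖v‖` when `‖g‖ ≤ C`. [folklore] -/
private theorem norm_shear_le {V : Type*} [NormedAddCommGroup V] [NormedSpace ℝ V] {g : ℝ → ℝ}
    {C : ℝ} (hgb : ∀ r, ‖g r‖ ≤ C) (v : V) (y : EuclideanSpace ℝ (Fin 3)) :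
    ‖g (y 1) • v‖ ≤ C * ‖v‖ := by
  rw [norm_smul]
  exact mul_le_mul_of_nonneg_right (hgb _) (norm_nonneg _)

/-- **The caloric extension of a shear field is the one-dimensional caloric extension of its
profile**: for a bounded continuous profile `g : ℝ → ℝ`, a vector `v` and `t > 0`,
`e^{tΔ}(g(·₁) v)(x) = (e^{t∂²}g)(x₁) v` on `ℝ³` — Fubini along the splitting `ℝ³ ≃ ℝ × ℝ²`
(`integral_eq_integral_integral_sideSplit`), the factorisation `G³_t(w₀, r, w₁) = G²_t(w) G¹_t(r)`
(`heatKernel_sideSplit_symm`) and `∫ G²_t = 1`. [folklore] -/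
private theorem heatExtension_shear {V : Type*} [NormedAddCommGroup V] [NormedSpace ℝ V]
    [CompleteSpace V] {g : ℝ → ℝ} (hgc : Continuous g) {C : ℝ} (hgb : ∀ r, ‖g r‖ ≤ C) (v : V)
    {t : ℝ} (ht : 0 < t) (x : EuclideanSpace ℝ (Fin 3)) :
    heatExtension (fun y : EuclideanSpace ℝ (Fin 3) => g (y 1) • v) t x =
      heatExtension (E := ℝ) g t (x 1) • v := by
  rw [UnboundedOperators.heatExtension_apply, UnboundedOperators.heatExtension_apply]
  have hF := UnboundedOperators.integrable_heatKernel_smul_of_bound (continuous_shear hgc v)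
    (norm_shear_le hgb v) ht x
  rw [integral_eq_integral_integral_sideSplit hF]
  have hinner : ∀ w : EuclideanSpace ℝ (Fin 2),
      ∫ r : ℝ, heatKernel t (sideSplit.symm (r, w)) •
          (fun y : EuclideanSpace ℝ (Fin 3) => g (y 1) • v) (x - sideSplit.symm (r, w)) =
        heatKernel t w • ((∫ r : ℝ, heatKernel (E := ℝ) t r • g (x 1 - r)) • v) := by
    intro w
    have h1 : ∀ r : ℝ, heatKernel t (sideSplit.symm (r, w)) •
        (fun y : EuclideanSpace ℝ (Fin 3) => g (y 1) • v) (x - sideSplit.symm (r, w)) =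
          heatKernel t w • ((heatKernel (E := ℝ) t r • g (x 1 - r)) • v) := fun r => by
      dsimp only
      rw [PiLp.sub_apply, sideSplit_symm_apply_one, heatKernel_sideSplit_symm ht, mul_smul]
      congr 1
      rw [smul_smul, smul_eq_mul]
    simp_rw [h1]
    rw [integral_smul, integral_smul_const]
  simp_rw [hinner]
  rw [integral_smul_const,
    UnboundedOperators.integral_heatKernel_eq_one_holds (E := EuclideanSpace ℝ (Fin 2)) ht, one_smul]

/-- **The caloric extension of the Gaussian shear** `b_τ(y) = G¹_τ(y₁) v`:
`e^{σΔ} b_τ = b_{τ+σ}` (`heatExtension_shear` and the semigroup law of the heat kernel of the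
line). [folklore] -/
private theorem heatExtension_gaussianShear {V : Type*} [NormedAddCommGroup V] [NormedSpace ℝ V]
    [CompleteSpace V] (v : V) {τ σ : ℝ} (hτ : 0 < τ) (hσ : 0 < σ) (x : EuclideanSpace ℝ (Fin 3)) :
    heatExtension (fun y : EuclideanSpace ℝ (Fin 3) => heatKernel (E := ℝ) τ (y 1) • v) σ x =
      heatKernel (E := ℝ) (τ + σ) (x 1) • v := by
  have hgb : ∀ r : ℝ, ‖heatKernel (E := ℝ) τ r‖ ≤ (4 * Real.pi * τ) ^ (-(Module.finrank ℝ ℝ : ℝ) / 2) :=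
    fun r => by
      rw [Real.norm_of_nonneg (UnboundedOperators.heatKernel_pos hτ r).le]
      exact UnboundedOperators.heatKernel_le hτ r
  rw [heatExtension_shear (UnboundedOperators.continuous_heatKernel τ) hgb v hσ x]
  congr 1
  have hconv := UnboundedOperators.heatKernel_convolution_heatKernel_holds (E := ℝ) hσ hτ
  have := congr_fun hconv (x 1)
  rw [add_comm σ τ] at this
  rw [← this]
  rfl

end Shear

/-! ### §4 The Gaussian shear `b_τ(y) = G¹_τ(y₁) v`: divergence, derivative along the axis, and the
slice `N_σ[e₁, b_τ]` in closed form -/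

section GaussianShear

/-- The derivative of the Gaussian shear `y ↦ G¹_s(y₁) • v` on `ℝ³`:
`D(G¹_s(·₁) v)(y)[h] = −(G¹_s(y₁)/(2s)) ⟪y₁, h₁⟫ v` (chain rule with the coordinate projection and
`∇G_s(r) = −(G_s(r)/(2s)) r`). [folklore] -/
private theorem hasFDerivAt_gaussianShear {V : Type*} [NormedAddCommGroup V] [NormedSpace ℝ V]
    (v : V) (s : ℝ) (y : EuclideanSpace ℝ (Fin 3)) :
    HasFDerivAt (fun y : EuclideanSpace ℝ (Fin 3) => heatKernel (E := ℝ) s (y 1) • v)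
      ((((-(heatKernel (E := ℝ) s (y 1) / (2 * s))) • innerSL ℝ (y 1)).comp
        (EuclideanSpace.proj (1 : Fin 3))).smulRight v) y := by
  have hp : HasFDerivAt (fun y : EuclideanSpace ℝ (Fin 3) => (y 1 : ℝ))
      (EuclideanSpace.proj (1 : Fin 3) : EuclideanSpace ℝ (Fin 3) →L[ℝ] ℝ) y :=
    (EuclideanSpace.proj (1 : Fin 3) : EuclideanSpace ℝ (Fin 3) →L[ℝ] ℝ).hasFDerivAt
  have h1 := ((UnboundedOperators.hasFDerivAt_heatKernel (E := ℝ) s (y 1)).comp y hp).smul_const v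
  exact h1

/-- The Gaussian shear is `C¹` (indeed smooth). [folklore] -/
private theorem contDiff_gaussianShear {V : Type*} [NormedAddCommGroup V] [NormedSpace ℝ V] (v : V)
    (s : ℝ) {n : WithTop ℕ∞} :
    ContDiff ℝ n (fun y : EuclideanSpace ℝ (Fin 3) => heatKernel (E := ℝ) s (y 1) • v) := by
  have hG : ContDiff ℝ n (heatKernel (E := ℝ) s) := FunctionSpaces.contDiff_heatKernel' (E := ℝ) s
  have hp : ContDiff ℝ n (fun y : EuclideanSpace ℝ (Fin 3) => (y 1 : ℝ)) :=
    (EuclideanSpace.proj (1 : Fin 3) : EuclideanSpace ℝ (Fin 3) →L[ℝ] ℝ).contDiff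
  exact (hG.comp hp).smul contDiff_const

/-- The derivative of the Gaussian shear along the axis `e₁`:
`∂₁(G¹_s(·₁) v)(y) = −(y₁ G¹_s(y₁)/(2s)) v`. [folklore] -/
private theorem fderiv_gaussianShear_single_one {V : Type*} [NormedAddCommGroup V] [NormedSpace ℝ V]
    (v : V) (s : ℝ) (y : EuclideanSpace ℝ (Fin 3)) :
    fderiv ℝ (fun y : EuclideanSpace ℝ (Fin 3) => heatKernel (E := ℝ) s (y 1) • v) y
        (EuclideanSpace.single 1 1) =
      (-(y 1 * heatKernel (E := ℝ) s (y 1) / (2 * s))) • v := by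
  rw [(hasFDerivAt_gaussianShear v s y).fderiv]
  have hproj : (EuclideanSpace.proj (1 : Fin 3) : EuclideanSpace ℝ (Fin 3) →L[ℝ] ℝ)
      (EuclideanSpace.single 1 1) = 1 := by
    show (EuclideanSpace.single (1 : Fin 3) (1 : ℝ) : EuclideanSpace ℝ (Fin 3)) 1 = 1
    simp
  rw [ContinuousLinearMap.smulRight_apply, ContinuousLinearMap.comp_apply, hproj,
    _root_.smul_apply, innerSL_apply_apply]
  congr 1
  simp only [smul_eq_mul]
  have : ⟪y 1, (1:ℝ)⟫ = y 1 := by simp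
  rw [this]
  ring

/-- The Gaussian shear `G¹_s(y₁) v` is divergence free when `v ⊥ e₁` (`v₁ = 0`): its derivative is
the rank-one map `h ↦ −(G¹_s(y₁)/(2s)) y₁ h₁ v`, of trace `∝ v₁ = 0`. [folklore] -/
private theorem isDivFree_gaussianShear {v : EuclideanSpace ℝ (Fin 3)} (hv : v 1 = 0) (s : ℝ) :
    VectorCalculus.IsDivFree
      (fun y : EuclideanSpace ℝ (Fin 3) => heatKernel (E := ℝ) s (y 1) • v) := by
  intro y
  rw [divergence_eq_sum_inner_fderiv (EuclideanSpace.basisFun (Fin 3) ℝ),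
    (hasFDerivAt_gaussianShear v s y).fderiv]
  have hproj : ∀ i : Fin 3, (EuclideanSpace.proj (1 : Fin 3) : EuclideanSpace ℝ (Fin 3) →L[ℝ] ℝ)
      (EuclideanSpace.single i 1) = (EuclideanSpace.single i (1:ℝ) : EuclideanSpace ℝ (Fin 3)) 1 :=
    fun i => rfl
  simp only [EuclideanSpace.basisFun_apply, ContinuousLinearMap.smulRight_apply,
    ContinuousLinearMap.comp_apply, _root_.smul_apply, hproj, inner_smul_right, Fin.sum_univ_three]
  rw [EuclideanSpace.inner_single_left, EuclideanSpace.inner_single_left,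
    EuclideanSpace.inner_single_left]
  simp [hv]

variable {τ : ℝ}

/-- The Gaussian shear is bounded by the peak of the profile: `‖G¹_τ(y₁) v‖ ≤ (4πτ)^{-1/2} ‖v‖`.
[folklore] -/
private theorem norm_gaussianShear_le {V : Type*} [NormedAddCommGroup V] [NormedSpace ℝ V] (v : V)
    (hτ : 0 < τ) (y : EuclideanSpace ℝ (Fin 3)) :
    ‖heatKernel (E := ℝ) τ (y 1) • v‖ ≤ (4 * Real.pi * τ) ^ (-(1 : ℝ) / 2) * ‖v‖ := by
  have hgb : ∀ r : ℝ, ‖heatKernel (E := ℝ) τ r‖ ≤ (4 * Real.pi * τ) ^ (-(1 : ℝ) / 2) := fun r => by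
    rw [Real.norm_of_nonneg (UnboundedOperators.heatKernel_pos hτ r).le]
    have := UnboundedOperators.heatKernel_le (E := ℝ) hτ r
    simpa [Module.finrank_self] using this
  exact norm_shear_le hgb v y

/-- **The Oseen slice of the Gaussian shear against the axial constant field, in closed form**:
for `σ, τ > 0` and `v ⊥ e₁`,

  `N_σ[e₁, G¹_τ(·₁) v](x) = −(x₁ G¹_{τ+σ}(x₁) / (2(τ+σ))) v`

— an exactly computable value of the slice operator of bounded fields
(`oseenSlice_const_left_eq_fderiv_heatExtension`, `heatExtension_gaussianShear`,
`fderiv_gaussianShear_single_one`). [cite: KochNadirashviliSereginSverak2009, §3 (3.3)–(3.5) (arXiv:0709.3599v1 p. 6)] -/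
theorem oseenSlice_single_one_gaussianShear {v : EuclideanSpace ℝ (Fin 3)} (hv : v 1 = 0)
    (hτ : 0 < τ) {σ : ℝ} (hσ : 0 < σ) (x : EuclideanSpace ℝ (Fin 3)) :
    oseenSlice σ (fun _ => EuclideanSpace.single 1 1)
        (fun y : EuclideanSpace ℝ (Fin 3) => heatKernel (E := ℝ) τ (y 1) • v) x =
      (-(x 1 * heatKernel (E := ℝ) (τ + σ) (x 1) / (2 * (τ + σ)))) • v := by
  have hbm : Measurable (fun y : EuclideanSpace ℝ (Fin 3) => heatKernel (E := ℝ) τ (y 1) • v) :=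
    (continuous_shear (UnboundedOperators.continuous_heatKernel τ) v).measurable
  have hdiv : IsWeaklyDivFree (fun y : EuclideanSpace ℝ (Fin 3) => heatKernel (E := ℝ) τ (y 1) • v) :=
    VectorCalculus.IsDivFree.isWeaklyDivFree_holds (isDivFree_gaussianShear hv τ)
      (contDiff_gaussianShear v τ)
  rw [oseenSlice_const_left_eq_fderiv_heatExtension hbm (norm_gaussianShear_le v hτ) hdiv _ hσ x]
  have hW : heatExtension (fun y : EuclideanSpace ℝ (Fin 3) => heatKernel (E := ℝ) τ (y 1) • v) σ =
      fun y : EuclideanSpace ℝ (Fin 3) => heatKernel (E := ℝ) (τ + σ) (y 1) • v :=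
    funext fun y => heatExtension_gaussianShear v hτ hσ y
  rw [hW, fderiv_gaussianShear_single_one]

end GaussianShear

/-! ### §5 The lower bound `C₀ ≥ e^{-1/2}/(2√2) > 1/5` -/

section LowerBound

/-- **The slice bound tested on the Gaussian shear**: with `σ = τ = 1`, `a ≡ e₁`, `b = G¹_1(·₁) e₀`
and the point `x = 2e₁`, the defining inequality `‖N_σ[a,b](x)‖ ≤ C₀ σ^{-1/2} ‖a‖_∞ ‖b‖_∞` of
`oseenSliceConst` reads `G¹_2(2)/2 ≤ C₀ (4π)^{-1/2}`. [cite: KochNadirashviliSereginSverak2009, §3 (3.5) and §4 p. 8 (arXiv:0709.3599v1)] -/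
theorem heatKernel_two_two_div_two_le_oseenSliceConst_mul :
    heatKernel (E := ℝ) 2 2 / 2 ≤
      oseenSliceConst (EuclideanSpace ℝ (Fin 3)) * (4 * Real.pi) ^ (-(1 : ℝ) / 2) := by
  set e₀ : EuclideanSpace ℝ (Fin 3) := EuclideanSpace.single 0 1 with he₀
  set e₁ : EuclideanSpace ℝ (Fin 3) := EuclideanSpace.single 1 1 with he₁
  set x₀ : EuclideanSpace ℝ (Fin 3) := EuclideanSpace.single 1 2 with hx₀
  have he₀1 : e₀ 1 = 0 := by simp [he₀]
  have hne₀ : ‖e₀‖ = 1 := by simp [he₀]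
  have hne₁ : ‖e₁‖ = 1 := by simp [he₁]
  have hx₀1 : x₀ 1 = 2 := by simp [hx₀]
  have ha : ∀ y : EuclideanSpace ℝ (Fin 3), ‖(fun _ : EuclideanSpace ℝ (Fin 3) => e₁) y‖ ≤ 1 :=
    fun _ => hne₁.le
  have hb : ∀ y : EuclideanSpace ℝ (Fin 3), ‖heatKernel (E := ℝ) 1 (y 1) • e₀‖ ≤
      (4 * Real.pi * 1) ^ (-(1 : ℝ) / 2) * ‖e₀‖ := fun y => norm_gaussianShear_le e₀ one_pos y
  have hN := norm_oseenSlice_le_oseenSliceConst (E := EuclideanSpace ℝ (Fin 3)) one_pos ha hb x₀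
  have hG : 0 < heatKernel (E := ℝ) 2 2 := UnboundedOperators.heatKernel_pos (by norm_num) 2
  have h2 : (1 : ℝ) + 1 = 2 := by norm_num
  have hval : ‖oseenSlice 1 (fun _ => e₁)
      (fun y : EuclideanSpace ℝ (Fin 3) => heatKernel (E := ℝ) 1 (y 1) • e₀) x₀‖ =
        heatKernel (E := ℝ) 2 2 / 2 := by
    rw [he₁, oseenSlice_single_one_gaussianShear he₀1 one_pos one_pos x₀, hx₀1, norm_smul, hne₀,
      mul_one, Real.norm_eq_abs, abs_neg, h2,
      abs_of_nonneg (div_nonneg (mul_nonneg zero_le_two hG.le) (by norm_num))]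
    ring
  have hrhs : oseenSliceConst (EuclideanSpace ℝ (Fin 3)) * (1 : ℝ) ^ (-(1 / 2 : ℝ)) * 1 *
      ((4 * Real.pi * 1) ^ (-(1 : ℝ) / 2) * ‖e₀‖) =
        oseenSliceConst (EuclideanSpace ℝ (Fin 3)) * (4 * Real.pi) ^ (-(1 : ℝ) / 2) := by
    simp only [hne₀, Real.one_rpow, mul_one]
  calc heatKernel (E := ℝ) 2 2 / 2 = _ := hval.symm
    _ ≤ _ := hN
    _ = _ := hrhs

/-- **An explicit lower bound for the Oseen slice constant of `ℝ³`**: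

  `e^{-1/2} / (2√2) ≤ C₀ = oseenSliceConst ℝ³`  (`e^{-1/2}/(2√2) = 0.2144…`).

The constant `C₀` of `‖N_σ[a, b]‖_∞ ≤ C₀ σ^{-1/2} ‖a‖_∞ ‖b‖_∞` (KNSS 2009, §3 (3.5), §4 p. 8) is
chosen by `Classical.choose` in the tree with no numerical information; whatever the choice, it
cannot be smaller than the ratio realised by the Gaussian shear
(`heatKernel_two_two_div_two_le_oseenSliceConst_mul`: `G¹_2(2)/2 = (8π)^{-1/2}e^{-1/2}/2` against
`(4π)^{-1/2}`). [cite: KochNadirashviliSereginSverak2009, §3 (3.5) and §4 p. 8 (arXiv:0709.3599v1)] -/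
theorem exp_neg_half_div_le_oseenSliceConst :
    Real.exp (-(1 / 2 : ℝ)) / (2 * Real.sqrt 2) ≤ oseenSliceConst (EuclideanSpace ℝ (Fin 3)) := by
  have hπ : 0 < 4 * Real.pi := by positivity
  have h := heatKernel_two_two_div_two_le_oseenSliceConst_mul
  -- the value of the one-dimensional heat kernel
  have hG : heatKernel (E := ℝ) 2 2 =
      (2 : ℝ) ^ (-(1 : ℝ) / 2) * (4 * Real.pi) ^ (-(1 : ℝ) / 2) * Real.exp (-(1 / 2 : ℝ)) := by
    rw [heatKernel_real_apply]
    have h8 : (4 : ℝ) * Real.pi * 2 = 2 * (4 * Real.pi) := by ring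
    rw [h8, Real.mul_rpow (by norm_num) hπ.le]
    congr 1
    norm_num
  -- `(4π)^{-1/2} > 0`, divide the tested inequality by it
  have hq : 0 < (4 * Real.pi) ^ (-(1 : ℝ) / 2) := Real.rpow_pos_of_pos hπ _
  rw [hG] at h
  have h' : (2 : ℝ) ^ (-(1 : ℝ) / 2) * Real.exp (-(1 / 2 : ℝ)) / 2 ≤
      oseenSliceConst (EuclideanSpace ℝ (Fin 3)) := by
    refine le_of_mul_le_mul_right ?_ hq
    calc (2 : ℝ) ^ (-(1 : ℝ) / 2) * Real.exp (-(1 / 2 : ℝ)) / 2 * (4 * Real.pi) ^ (-(1 : ℝ) / 2)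
        = (2 : ℝ) ^ (-(1 : ℝ) / 2) * (4 * Real.pi) ^ (-(1 : ℝ) / 2) * Real.exp (-(1 / 2 : ℝ)) / 2 := by
          ring
      _ ≤ _ := h
  -- `2^{-1/2} = 1/√2`
  have hs : (2 : ℝ) ^ (-(1 : ℝ) / 2) = (Real.sqrt 2)⁻¹ := by
    rw [Real.sqrt_eq_rpow, ← Real.rpow_neg (by norm_num)]
    norm_num
  rw [hs] at h'
  have hs0 : 0 < Real.sqrt 2 := Real.sqrt_pos.2 (by norm_num)
  calc Real.exp (-(1 / 2 : ℝ)) / (2 * Real.sqrt 2) = (Real.sqrt 2)⁻¹ * Real.exp (-(1 / 2 : ℝ)) / 2 := by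
        field_simp
    _ ≤ _ := h'

/-- **Corollary**: `1/5 ≤ oseenSliceConst ℝ³` (since `2√2·e^{1/2} = √(8e) < √21.75 < 5`): the
constant of KNSS 2009, §3 (3.5) / §4 p. 8, as chosen in the tree, is at least `1/5`.
[cite: KochNadirashviliSereginSverak2009, §3 (3.5) and §4 p. 8 (arXiv:0709.3599v1)] -/
theorem one_fifth_le_oseenSliceConst : (1 / 5 : ℝ) ≤ oseenSliceConst (EuclideanSpace ℝ (Fin 3)) := by
  refine le_trans ?_ exp_neg_half_div_le_oseenSliceConst
  have he : Real.exp 1 < 2.7182818286 := Real.exp_one_lt_d9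
  have ha : 0 < Real.exp (1 / 2 : ℝ) := Real.exp_pos _
  have hb : 0 < Real.sqrt 2 := Real.sqrt_pos.2 (by norm_num)
  have ha2 : Real.exp (1 / 2 : ℝ) ^ 2 = Real.exp 1 := by
    rw [← Real.exp_nat_mul]; norm_num
  have hb2 : Real.sqrt 2 ^ 2 = 2 := Real.sq_sqrt (by norm_num)
  have hprod : 2 * Real.sqrt 2 * Real.exp (1 / 2 : ℝ) ≤ 5 := by
    nlinarith [mul_pos hb ha, sq_nonneg (2 * Real.sqrt 2 * Real.exp (1 / 2 : ℝ) - 5),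
      sq_nonneg (2 * Real.sqrt 2 * Real.exp (1 / 2 : ℝ) + 5)]
  rw [Real.exp_neg, div_eq_mul_inv, le_div_iff₀ (by positivity)]
  -- goal: 1/5 * (2√2) ≤ (exp (1/2))⁻¹
  rw [le_inv_comm₀ (by positivity) ha]
  calc Real.exp (1 / 2 : ℝ) = 2 * Real.sqrt 2 * Real.exp (1 / 2 : ℝ) / (2 * Real.sqrt 2) := by
        field_simp
    _ ≤ 5 / (2 * Real.sqrt 2) := by gcongr
    _ = (1 / 5 * (2 * Real.sqrt 2))⁻¹ := by field_simp

end LowerBound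

/-! ### §6 General `C¹` shear profiles and the sharp shear bound `C₀ ≥ π^{-1/2}` -/

section ShearProfile

variable {V : Type*} [NormedAddCommGroup V] [NormedSpace ℝ V]

/-- The derivative of a shear field `g(y₁) v` with `C¹` profile:
`D(g(·₁)v)(y) = (∂g(y₁) • proj₁) v`. [folklore] -/
private theorem hasFDerivAt_shear {g : ℝ → ℝ} (hg : Differentiable ℝ g) (v : V)
    (y : EuclideanSpace ℝ (Fin 3)) :
    HasFDerivAt (fun y : EuclideanSpace ℝ (Fin 3) => g (y 1) • v)
      ((fderiv ℝ g (y 1) 1 • (EuclideanSpace.proj (1 : Fin 3) : EuclideanSpace ℝ (Fin 3) →L[ℝ] ℝ))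
        |>.smulRight v) y := by
  have hp : HasFDerivAt (fun y : EuclideanSpace ℝ (Fin 3) => (y 1 : ℝ))
      (EuclideanSpace.proj (1 : Fin 3) : EuclideanSpace ℝ (Fin 3) →L[ℝ] ℝ) y :=
    (EuclideanSpace.proj (1 : Fin 3) : EuclideanSpace ℝ (Fin 3) →L[ℝ] ℝ).hasFDerivAt
  have hd : HasDerivAt g (fderiv ℝ g (y 1) 1) (y 1) := by
    rw [fderiv_apply_one_eq_deriv]
    exact (hg (y 1)).hasDerivAt
  have h1 := (hd.comp_hasFDerivAt y hp).smul_const v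
  exact h1

/-- The derivative of a `C¹` shear along the axis: `∂₁(g(·₁)v)(y) = g′(y₁) v`. [folklore] -/
private theorem fderiv_shear_single_one {g : ℝ → ℝ} (hg : Differentiable ℝ g) (v : V)
    (y : EuclideanSpace ℝ (Fin 3)) :
    fderiv ℝ (fun y : EuclideanSpace ℝ (Fin 3) => g (y 1) • v) y (EuclideanSpace.single 1 1) =
      fderiv ℝ g (y 1) 1 • v := by
  rw [(hasFDerivAt_shear hg v y).fderiv]
  have hproj : (EuclideanSpace.proj (1 : Fin 3) : EuclideanSpace ℝ (Fin 3) →L[ℝ] ℝ)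
      (EuclideanSpace.single 1 1) = 1 := by
    show (EuclideanSpace.single (1 : Fin 3) (1 : ℝ) : EuclideanSpace ℝ (Fin 3)) 1 = 1
    simp
  rw [ContinuousLinearMap.smulRight_apply, _root_.smul_apply, hproj, smul_eq_mul, mul_one]

/-- A `C¹` shear `g(y₁) v` with `v ⊥ e₁` (`v₁ = 0`) is divergence free. [folklore] -/
private theorem isDivFree_shear {g : ℝ → ℝ} (hg : Differentiable ℝ g) {v : EuclideanSpace ℝ (Fin 3)}
    (hv : v 1 = 0) :
    VectorCalculus.IsDivFree (fun y : EuclideanSpace ℝ (Fin 3) => g (y 1) • v) := by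
  intro y
  rw [divergence_eq_sum_inner_fderiv (EuclideanSpace.basisFun (Fin 3) ℝ), (hasFDerivAt_shear hg v y).fderiv]
  have hproj : ∀ i : Fin 3, (EuclideanSpace.proj (1 : Fin 3) : EuclideanSpace ℝ (Fin 3) →L[ℝ] ℝ)
      (EuclideanSpace.single i 1) = (EuclideanSpace.single i (1:ℝ) : EuclideanSpace ℝ (Fin 3)) 1 :=
    fun i => rfl
  simp only [EuclideanSpace.basisFun_apply, ContinuousLinearMap.smulRight_apply,
    _root_.smul_apply, hproj, inner_smul_right, Fin.sum_univ_three]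
  rw [EuclideanSpace.inner_single_left, EuclideanSpace.inner_single_left,
    EuclideanSpace.inner_single_left]
  simp [hv]

/-- **The Oseen slice of a `C¹` shear against the axial constant field**: for `g ∈ C¹(ℝ)` bounded
with bounded derivative, `v ⊥ e₁` and `σ > 0`,

  `N_σ[e₁, g(·₁) v](x) = (e^{σ∂²} g′)(x₁) v`

(`oseenSlice_const_left_eq_fderiv_heatExtension`, `heatExtension_shear`, derivatives fall on bounded
`C¹` data). [cite: KochNadirashviliSereginSverak2009, §3 (3.3)–(3.5) (arXiv:0709.3599v1 p. 6)] -/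
theorem oseenSlice_single_one_shear {g : ℝ → ℝ} (hg : ContDiff ℝ 1 g) {C C' : ℝ}
    (hg0 : ∀ r, ‖g r‖ ≤ C) (hg1 : ∀ r, ‖fderiv ℝ g r 1‖ ≤ C') {v : EuclideanSpace ℝ (Fin 3)}
    (hv : v 1 = 0) {σ : ℝ} (hσ : 0 < σ) (x : EuclideanSpace ℝ (Fin 3)) :
    oseenSlice σ (fun _ => EuclideanSpace.single 1 1)
        (fun y : EuclideanSpace ℝ (Fin 3) => g (y 1) • v) x =
      heatExtension (E := ℝ) (fun r => fderiv ℝ g r 1) σ (x 1) • v := by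
  have hgd : Differentiable ℝ g := hg.differentiable one_ne_zero
  have hbm : Measurable (fun y : EuclideanSpace ℝ (Fin 3) => g (y 1) • v) :=
    (continuous_shear hg.continuous v).measurable
  have hb1 : ContDiff ℝ 1 (fun y : EuclideanSpace ℝ (Fin 3) => g (y 1) • v) :=
    (hg.comp (EuclideanSpace.proj (1 : Fin 3) : EuclideanSpace ℝ (Fin 3) →L[ℝ] ℝ).contDiff).smul
      contDiff_const
  have hdiv : IsWeaklyDivFree (fun y : EuclideanSpace ℝ (Fin 3) => g (y 1) • v) :=
    VectorCalculus.IsDivFree.isWeaklyDivFree_holds (isDivFree_shear hgd hv) hb1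
  rw [oseenSlice_const_left_eq_fderiv_heatExtension hbm (norm_shear_le hg0 v) hdiv _ hσ x]
  have hW : heatExtension (fun y : EuclideanSpace ℝ (Fin 3) => g (y 1) • v) σ =
      fun y : EuclideanSpace ℝ (Fin 3) => heatExtension (E := ℝ) g σ (y 1) • v :=
    funext fun y => heatExtension_shear hg.continuous hg0 v hσ y
  rw [hW]
  -- the one-dimensional caloric extension is `C¹` with derivative `e^{σ∂²}(g′)`
  have hG1 : ContDiff ℝ 1 (heatExtension (E := ℝ) g σ) :=
    UnboundedOperators.contDiff_heatExtension_of_bound hg.continuous hg0 hσ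
  rw [fderiv_shear_single_one (hG1.differentiable one_ne_zero) v x,
    UnboundedOperators.fderiv_heatExtension_apply_of_bounded hg hg0 hg1 hσ (x 1)]

end ShearProfile

section ErfProfile

/-- The odd primitive of the heat kernel of the line, `Φ_τ(r) = ∫_{-r}^{r} G¹_τ = ∫₀ʳ G¹_τ − ∫₀^{-r} G¹_τ`
(an error-function profile with values in `(-1, 1)`): its derivative is `2G¹_τ(r)`. [folklore] -/
private theorem hasDerivAt_erfProfile {τ : ℝ} (r : ℝ) :
    HasDerivAt (fun r : ℝ => (∫ s in (0 : ℝ)..r, heatKernel (E := ℝ) τ s) -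
        ∫ s in (0 : ℝ)..(-r), heatKernel (E := ℝ) τ s) (2 * heatKernel (E := ℝ) τ r) r := by
  have hc : Continuous (heatKernel (E := ℝ) τ) := UnboundedOperators.continuous_heatKernel τ
  have hF : ∀ u : ℝ, HasDerivAt (fun r : ℝ => ∫ s in (0 : ℝ)..r, heatKernel (E := ℝ) τ s)
      (heatKernel (E := ℝ) τ u) u := fun u =>
    intervalIntegral.integral_hasDerivAt_right (hc.intervalIntegrable _ _)
      (hc.stronglyMeasurableAtFilter _ _) hc.continuousAt
  have hneg : HasDerivAt (fun r : ℝ => ∫ s in (0 : ℝ)..(-r), heatKernel (E := ℝ) τ s)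
      ((-1 : ℝ) • heatKernel (E := ℝ) τ (-r)) r := by
    have := (hF (-r)).scomp r (hasDerivAt_neg r)
    exact this
  have heven : heatKernel (E := ℝ) τ (-r) = heatKernel (E := ℝ) τ r := by
    simp [UnboundedOperators.heatKernel]
  exact ((hF r).sub hneg).congr_deriv (by rw [heven, smul_eq_mul]; ring)

/-- `Φ_τ(r) = ∫_{-r}^{r} G¹_τ`. [folklore] -/
private theorem erfProfile_eq_intervalIntegral {τ : ℝ} (r : ℝ) :
    ((∫ s in (0 : ℝ)..r, heatKernel (E := ℝ) τ s) - ∫ s in (0 : ℝ)..(-r), heatKernel (E := ℝ) τ s) =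
      ∫ s in (-r)..r, heatKernel (E := ℝ) τ s :=
  intervalIntegral.integral_interval_sub_left
    ((UnboundedOperators.continuous_heatKernel τ).intervalIntegrable _ _)
    ((UnboundedOperators.continuous_heatKernel τ).intervalIntegrable _ _)

/-- `|Φ_τ| ≤ 1` (the Gaussian has mass one). [folklore] -/
private theorem abs_erfProfile_le_one {τ : ℝ} (hτ : 0 < τ) (r : ℝ) :
    ‖(∫ s in (0 : ℝ)..r, heatKernel (E := ℝ) τ s) - ∫ s in (0 : ℝ)..(-r), heatKernel (E := ℝ) τ s‖ ≤ 1 := by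
  have hint : Integrable (heatKernel (E := ℝ) τ) := UnboundedOperators.integrable_heatKernel_holds hτ
  have hnn : 0 ≤ᵐ[volume] heatKernel (E := ℝ) τ :=
    Eventually.of_forall fun s => (UnboundedOperators.heatKernel_pos hτ s).le
  -- for `0 ≤ ρ`: `0 ≤ ∫_{-ρ}^{ρ} G ≤ 1`
  have key : ∀ ρ : ℝ, 0 ≤ ρ → 0 ≤ ∫ s in (-ρ)..ρ, heatKernel (E := ℝ) τ s ∧
      ∫ s in (-ρ)..ρ, heatKernel (E := ℝ) τ s ≤ 1 := by
    intro ρ hρ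
    rw [intervalIntegral.integral_of_le (by linarith)]
    refine ⟨setIntegral_nonneg measurableSet_Ioc fun s _ => (UnboundedOperators.heatKernel_pos hτ s).le,
      ?_⟩
    calc ∫ s in Ioc (-ρ) ρ, heatKernel (E := ℝ) τ s ≤ ∫ s, heatKernel (E := ℝ) τ s :=
          setIntegral_le_integral hint hnn
      _ = 1 := UnboundedOperators.integral_heatKernel_eq_one_holds hτ
  rw [erfProfile_eq_intervalIntegral, Real.norm_eq_abs]
  rcases le_or_gt 0 r with hr | hr
  · obtain ⟨h0, h1⟩ := key r hr
    rw [abs_of_nonneg h0]; exact h1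
  · obtain ⟨h0, h1⟩ := key (-r) (by linarith)
    rw [neg_neg] at h0 h1
    rw [intervalIntegral.integral_symm, abs_neg, abs_of_nonneg h0]
    exact h1

/-- `Φ_τ ∈ C¹` with `Φ_τ′ = 2G¹_τ` bounded by `2(4πτ)^{-1/2}`. [folklore] -/
private theorem contDiff_erfProfile {τ : ℝ} :
    ContDiff ℝ 1 (fun r : ℝ => (∫ s in (0 : ℝ)..r, heatKernel (E := ℝ) τ s) -
        ∫ s in (0 : ℝ)..(-r), heatKernel (E := ℝ) τ s) := by
  rw [contDiff_one_iff_deriv]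
  refine ⟨fun r => (hasDerivAt_erfProfile r).differentiableAt, ?_⟩
  have : deriv (fun r : ℝ => (∫ s in (0 : ℝ)..r, heatKernel (E := ℝ) τ s) -
      ∫ s in (0 : ℝ)..(-r), heatKernel (E := ℝ) τ s) = fun r => 2 * heatKernel (E := ℝ) τ r :=
    funext fun r => (hasDerivAt_erfProfile r).deriv
  rw [this]
  exact continuous_const.mul (UnboundedOperators.continuous_heatKernel τ)

/-- `Φ_τ′(r) = 2G¹_τ(r)` as a Fréchet derivative applied to `1`. [folklore] -/
private theorem fderiv_erfProfile_apply_one {τ : ℝ} (r : ℝ) :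
    fderiv ℝ (fun r : ℝ => (∫ s in (0 : ℝ)..r, heatKernel (E := ℝ) τ s) -
        ∫ s in (0 : ℝ)..(-r), heatKernel (E := ℝ) τ s) r 1 = 2 * heatKernel (E := ℝ) τ r := by
  rw [fderiv_apply_one_eq_deriv, (hasDerivAt_erfProfile r).deriv]

/-- **The slice bound tested on the error-function shear**: with `σ = 1`, `a ≡ e₁`,
`b = Φ_τ(·₁) e₀` (`|Φ_τ| ≤ 1`) and `x = 0`, `N_1[a, b](0) = 2G¹_{τ+1}(0) e₀`, so the defining inequality
of `oseenSliceConst` gives `2(4π(1+τ))^{-1/2} ≤ C₀` for every `τ > 0`.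
[cite: KochNadirashviliSereginSverak2009, §3 (3.5) and §4 p. 8 (arXiv:0709.3599v1)] -/
theorem two_mul_rpow_le_oseenSliceConst {τ : ℝ} (hτ : 0 < τ) :
    2 * (4 * Real.pi * (τ + 1)) ^ (-(1 : ℝ) / 2) ≤ oseenSliceConst (EuclideanSpace ℝ (Fin 3)) := by
  set e₀ : EuclideanSpace ℝ (Fin 3) := EuclideanSpace.single 0 1 with he₀
  set e₁ : EuclideanSpace ℝ (Fin 3) := EuclideanSpace.single 1 1 with he₁
  set Φ : ℝ → ℝ := fun r => (∫ s in (0 : ℝ)..r, heatKernel (E := ℝ) τ s) -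
    ∫ s in (0 : ℝ)..(-r), heatKernel (E := ℝ) τ s with hΦ
  have he₀1 : e₀ 1 = 0 := by simp [he₀]
  have hne₀ : ‖e₀‖ = 1 := by simp [he₀]
  have hne₁ : ‖e₁‖ = 1 := by simp [he₁]
  have ha : ∀ y : EuclideanSpace ℝ (Fin 3), ‖(fun _ : EuclideanSpace ℝ (Fin 3) => e₁) y‖ ≤ 1 :=
    fun _ => hne₁.le
  have hΦ0 : ∀ r, ‖Φ r‖ ≤ 1 := fun r => abs_erfProfile_le_one hτ r
  have hΦ1 : ∀ r, ‖fderiv ℝ Φ r 1‖ ≤ 2 * (4 * Real.pi * τ) ^ (-(1 : ℝ) / 2) := fun r => by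
    rw [hΦ, fderiv_erfProfile_apply_one r, Real.norm_of_nonneg
      (mul_nonneg zero_le_two (UnboundedOperators.heatKernel_pos hτ r).le)]
    have := UnboundedOperators.heatKernel_le (E := ℝ) hτ r
    have h' : heatKernel (E := ℝ) τ r ≤ (4 * Real.pi * τ) ^ (-(1 : ℝ) / 2) := by
      simpa [Module.finrank_self] using this
    linarith
  have hb : ∀ y : EuclideanSpace ℝ (Fin 3), ‖Φ (y 1) • e₀‖ ≤ 1 * ‖e₀‖ := fun y => norm_shear_le hΦ0 e₀ y
  have hN := norm_oseenSlice_le_oseenSliceConst (E := EuclideanSpace ℝ (Fin 3)) one_pos ha hb 0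
  have hval : ‖oseenSlice 1 (fun _ => e₁) (fun y : EuclideanSpace ℝ (Fin 3) => Φ (y 1) • e₀) 0‖ =
      2 * (4 * Real.pi * (τ + 1)) ^ (-(1 : ℝ) / 2) := by
    rw [he₁, oseenSlice_single_one_shear contDiff_erfProfile hΦ0 hΦ1 he₀1 one_pos 0]
    have hD : (fun r => fderiv ℝ Φ r 1) = fun r => (2 : ℝ) • heatKernel (E := ℝ) τ r :=
      funext fun r => by rw [hΦ, fderiv_erfProfile_apply_one r, smul_eq_mul]
    rw [hD, UnboundedOperators.heatExtension_const_smul]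
    have h0 : (0 : EuclideanSpace ℝ (Fin 3)) 1 = 0 := rfl
    rw [h0]
    have hconv := congr_fun (UnboundedOperators.heatKernel_convolution_heatKernel_holds (E := ℝ)
      one_pos hτ) 0
    have hext : heatExtension (E := ℝ) (heatKernel (E := ℝ) τ) 1 0 = heatKernel (E := ℝ) (1 + τ) 0 := by
      rw [← hconv]; rfl
    rw [hext, norm_smul, hne₀, mul_one, heatKernel_real_apply, Real.norm_of_nonneg (by positivity)]
    simp only [smul_eq_mul]
    rw [add_comm 1 τ]
    simp
  calc 2 * (4 * Real.pi * (τ + 1)) ^ (-(1 : ℝ) / 2) = _ := hval.symm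
    _ ≤ _ := hN
    _ = oseenSliceConst (EuclideanSpace ℝ (Fin 3)) := by
        simp only [hne₀, Real.one_rpow, mul_one]

/-- **The sharp shear lower bound**: `π^{-1/2} ≤ oseenSliceConst ℝ³` (`π^{-1/2} = 0.5641…`), the limit
`τ → 0⁺` of `two_mul_rpow_le_oseenSliceConst` (`2(4π)^{-1/2} = π^{-1/2}`): the slice constant of
KNSS 2009, §3 (3.5) / §4 p. 8, as chosen in the tree, exceeds `1/2`.
[cite: KochNadirashviliSereginSverak2009, §3 (3.5) and §4 p. 8 (arXiv:0709.3599v1)] -/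
theorem inv_sqrt_pi_le_oseenSliceConst :
    (Real.sqrt Real.pi)⁻¹ ≤ oseenSliceConst (EuclideanSpace ℝ (Fin 3)) := by
  have hπ : 0 < Real.pi := Real.pi_pos
  -- the limit `τ → 0⁺`
  have hcont : ContinuousAt (fun τ : ℝ => 2 * (4 * Real.pi * (τ + 1)) ^ (-(1 : ℝ) / 2)) 0 := by
    have h1 : ContinuousAt (fun τ : ℝ => 4 * Real.pi * (τ + 1)) 0 := by fun_prop
    have h2 : ContinuousAt (fun τ : ℝ => (4 * Real.pi * (τ + 1)) ^ (-(1 : ℝ) / 2)) 0 :=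
      h1.rpow_const (Or.inl (by positivity))
    exact continuousAt_const.mul h2
  have hlim : Tendsto (fun τ : ℝ => 2 * (4 * Real.pi * (τ + 1)) ^ (-(1 : ℝ) / 2)) (𝓝[>] 0)
      (𝓝 (2 * (4 * Real.pi * (0 + 1)) ^ (-(1 : ℝ) / 2))) :=
    hcont.tendsto.mono_left nhdsWithin_le_nhds
  have hle : 2 * (4 * Real.pi * (0 + 1)) ^ (-(1 : ℝ) / 2) ≤ oseenSliceConst (EuclideanSpace ℝ (Fin 3)) :=
    le_of_tendsto hlim (eventually_nhdsWithin_of_forall fun τ hτ => two_mul_rpow_le_oseenSliceConst hτ)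
  -- `2(4π)^{-1/2} = π^{-1/2}`
  have hval : 2 * (4 * Real.pi * (0 + 1)) ^ (-(1 : ℝ) / 2) = (Real.sqrt Real.pi)⁻¹ := by
    rw [zero_add, mul_one, Real.mul_rpow (by norm_num) hπ.le]
    have h4 : (4 : ℝ) ^ (-(1 : ℝ) / 2) = 1 / 2 := by
      rw [show (4 : ℝ) = 2 ^ (2 : ℝ) by norm_num, ← Real.rpow_mul (by norm_num)]
      norm_num
    have hp : Real.pi ^ (-(1 : ℝ) / 2) = (Real.sqrt Real.pi)⁻¹ := by
      rw [Real.sqrt_eq_rpow, ← Real.rpow_neg hπ.le, show (-(1 : ℝ) / 2) = -(1 / 2 : ℝ) by ring]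
    rw [h4, hp]
    ring
  rw [hval] at hle
  exact hle

end ErfProfile

end Literature.Analysis.FluidPDE
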